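import Summits.CriticalPhenomena.SAWScalingLimit.Theorems.SAWLoopFugacityFlowIsingBoundaryRatioWindowRectHoleCells
import Literature.Probability.LatticeModels.DiscreteRectBoundaryTrace
import Literature.Probability.LatticeModels.CornerPermutation
import Literature.Probability.LatticeModels.MeshDomainBigComponents
import HarnessLib

/-!
# Holes of an edge set of the mesh graph: combinatorics
(line `fk-anchor-transfer`, crux `IsingBoundaryRatio`, stmt-CriticalPhenomena-10650; helper file of the stub
`windowRectPresentation_holds`)

For a finite set `E₀` of edges of the mesh graph `Ω_δ` of a Jordan domain `D`, a face `a` of `δℤ²`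
ESCAPES if faces of arbitrary height can be reached from `a` by steps to side-adjacent faces across sides
NOT in `E₀` (the step relation is passed as a parameter `S` with its characterisation `hS`, to keep the
statements short); the non-escaping faces are the HOLE FACES. We prove:

* `holeStep_symm`, `not_esc_of_step` — the step relation is symmetric and the hole is closed under it, so a
  side between a hole face and a non-hole face is an edge of `E₀` (`mem_of_hole_of_not_hole`);
* `esc_of_*`, `finite_hole` — faces outside the bounding box of the vertices of `E₀` escape: the hole is
  finite;
* `hole_faceAt_of_not_mem_verts` — round a corner of a hole face that is not a vertex of `E₀`, all four faces
  are hole faces;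
* `hole_closure_property` — the hypothesis of `…WindowRectHoleCells`, whence (`meshPoint_corner_mem_hole`,
  `adj_of_hole_side`) the corners of hole faces lie in `D`, in `Ω_δ = meshDomain`, and the sides of hole faces
  are edges of `Ω_δ`; `exists_chain_exit_of_hole` — every corner of a hole face is joined through sides of
  hole faces to a vertex of `E₀`.

[folklore]
-/

noncomputable section

open Set Metric Complex SimpleGraph Literature.Probability.RandomPlanarGeometry Literature.Probability.LatticeModels
  Literature.Probability.LatticeModels.Mesh Literature.Probability.LatticeModels.DiscreteRect

namespace Summit.CriticalPhenomena.SAWScalingLimit.Theorems.IsingBoundaryRatio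

namespace WindowRect

/-! ### Lattice bookkeeping: common corners, sides -/

/-- The common corners of the faces `a` and `a + cornerUnit k` are the two ends of their common side.
[folklore] -/
theorem eq_of_isCorner_of_isCorner_add {v a : Site 2} {k : Fin 4} (hva : IsCorner v a)
    (hvb : IsCorner v (a + cornerUnit k)) : v = a + cornerOff (k + 1) ∨ v = a + cornerOff (k + 2) := by
  have h0 := hva 0; have h1 := hva 1; have g0 := hvb 0; have g1 := hvb 1
  simp only [Pi.add_apply] at g0 g1
  rw [Site.eq_iff_two, Site.eq_iff_two]
  simp only [Pi.add_apply]
  fin_cases k <;> simp [cornerUnit, cornerOff] at g0 g1 ⊢ <;> omega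

/-- The two ends of the common side are common corners. [folklore] -/
theorem isCorner_add_cornerOff_both (a : Site 2) (k : Fin 4) :
    (IsCorner (a + cornerOff (k + 1)) a ∧ IsCorner (a + cornerOff (k + 1)) (a + cornerUnit k)) ∧
      (IsCorner (a + cornerOff (k + 2)) a ∧ IsCorner (a + cornerOff (k + 2)) (a + cornerUnit k)) := by
  refine ⟨⟨?_, ?_⟩, ?_, ?_⟩ <;> intro i <;> fin_cases i <;> fin_cases k <;>
    simp [cornerUnit, cornerOff, Pi.add_apply]

/-- The two ends of the common side are lattice neighbours. [folklore] -/
theorem adj_cornerOff_succ (a : Site 2) (k : Fin 4) :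
    (zdGraph 2).Adj (a + cornerOff (k + 1)) (a + cornerOff (k + 2)) := by
  have : a + cornerOff (k + 2) = a + cornerOff (k + 1) + cornerUnit (k + 1) := by
    rw [cornerUnit_eq_off_sub, fin4_add_one_add_one]; abel
  rw [this]
  exact zdGraph_adj_add_cornerUnit _ _

/-- `DiscreteRect.dir = cornerUnit`. [folklore] -/
theorem dir_eq_cornerUnit (k : Fin 4) : dir k = cornerUnit k := by
  fin_cases k <;> rfl

/-- `DiscreteRect.corner a j = a + cornerOff j`. [folklore] -/
theorem corner_eq_add_cornerOff (a : Site 2) (j : Fin 4) : DiscreteRect.corner a j = a + cornerOff j := by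
  rw [Site.eq_iff_two]
  fin_cases j <;> simp [DiscreteRect.corner, cornerOff, dir, Pi.add_apply]

/-- The side of `a` crossed towards `a + e_k`, in `DiscreteRect` vocabulary: with `j = k + 1`,
`s(corner a j, corner a j + dir j) = s(a + cornerOff (k+1), a + cornerOff (k+2))`. [folklore] -/
theorem side_eq (a : Site 2) (k : Fin 4) :
    s(DiscreteRect.corner a (k + 1), DiscreteRect.corner a (k + 1) + dir (k + 1)) =
      s(a + cornerOff (k + 1), a + cornerOff (k + 2)) := by
  rw [corner_eq_add_cornerOff, dir_eq_cornerUnit, cornerUnit_eq_off_sub, fin4_add_one_add_one]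
  congr 1
  abel

variable (D : JordanDomain) {δ : ℝ} (hδ : 0 < δ) {E₀ : Finset (Sym2 (Site 2))}
  (hE₀ : ∀ e ∈ E₀, e ∈ (discreteDomainGraph D.carrier δ).edgeSet)
  {S : Site 2 → Site 2 → Prop}
  (hS : ∀ a b, S a b ↔ ∃ k : Fin 4, b = a + cornerUnit k ∧ s(a + cornerOff (k + 1), a + cornerOff (k + 2)) ∉ E₀)

/-! ### The step relation and the hole -/

section Step

include hS

/-- The step relation is symmetric. [folklore] -/
theorem holeStep_symm {a b : Site 2} (h : S a b) : S b a := by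
  rw [hS] at h ⊢
  obtain ⟨k, rfl, hk⟩ := h
  refine ⟨k + 2, ?_, ?_⟩
  · rw [cornerUnit_add_two]; abel
  · have e1 : a + cornerUnit k + cornerOff (k + 2 + 1) = a + cornerOff (k + 2) := by
      rw [fin4_add_two_add_one, show cornerOff (k + 3) = cornerOff (k + 2) + cornerUnit (k + 2) by
        rw [cornerUnit_eq_off_sub, fin4_add_two_add_one]; abel, cornerUnit_add_two]; abel
    have e2 : a + cornerUnit k + cornerOff (k + 2 + 2) = a + cornerOff (k + 1) := by
      rw [fin4_add_two_add_two', cornerUnit_eq_off_sub]; abel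
    rw [e1, e2, Sym2.eq_swap]
    exact hk

/-- Steps are lattice adjacencies. [folklore] -/
theorem adj_of_holeStep {a b : Site 2} (h : S a b) : (zdGraph 2).Adj a b := by
  rw [hS] at h
  obtain ⟨k, rfl, -⟩ := h
  exact zdGraph_adj_add_cornerUnit _ _

omit hS in
/-- The hole is closed under steps: a face one can step to from a non-escaping face does not escape.
[folklore] -/
theorem not_esc_of_step {a b : Site 2} (h : S a b)
    (ha : ¬ ∀ M : ℤ, ∃ g' : Site 2, M ≤ g' 1 ∧ Relation.ReflTransGen S a g') :
    ¬ ∀ M : ℤ, ∃ g' : Site 2, M ≤ g' 1 ∧ Relation.ReflTransGen S b g' := by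
  intro hb
  apply ha
  intro M
  obtain ⟨g', hM, hchain⟩ := hb M
  exact ⟨g', hM, Relation.ReflTransGen.head h hchain⟩

/-- Reachability by steps is symmetric. [folklore] -/
theorem reflTransGen_holeStep_symm {a b : Site 2} (h : Relation.ReflTransGen S a b) : Relation.ReflTransGen S b a := by
  induction h with
  | refl => exact Relation.ReflTransGen.refl
  | tail _ hbc ih => exact Relation.ReflTransGen.head (holeStep_symm hS hbc) ih

/-- Faces reachable from an escaping face escape. [folklore] -/
theorem esc_of_reflTransGen {a b : Site 2} (h : Relation.ReflTransGen S a b)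
    (ha : ∀ M : ℤ, ∃ g' : Site 2, M ≤ g' 1 ∧ Relation.ReflTransGen S a g') :
    ∀ M : ℤ, ∃ g' : Site 2, M ≤ g' 1 ∧ Relation.ReflTransGen S b g' := by
  induction h with
  | refl => exact ha
  | tail _ hbc ih =>
    by_contra hc
    exact not_esc_of_step (holeStep_symm hS hbc) hc ih

/-- **A side between a hole face and a side-adjacent non-hole face is an edge of `E₀`.** [folklore] -/
theorem mem_of_hole_of_not_hole {a : Site 2} {k : Fin 4}
    (ha : ¬ ∀ M : ℤ, ∃ g' : Site 2, M ≤ g' 1 ∧ Relation.ReflTransGen S a g')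
    (hb : ∀ M : ℤ, ∃ g' : Site 2, M ≤ g' 1 ∧ Relation.ReflTransGen S (a + cornerUnit k) g') :
    s(a + cornerOff (k + 1), a + cornerOff (k + 2)) ∈ E₀ := by
  by_contra hk
  exact not_esc_of_step ((hS _ _).2 ⟨k, rfl, hk⟩) ha hb

/-! ### Faces outside the bounding box escape -/

/-- A face all of whose translates in direction `k` have their crossed side off the vertices of `E₀`... 
concretely: if every side crossed when walking from `a` in direction `e₁` (up) misses `E₀`, `a` escapes.
[folklore] -/
theorem esc_of_free_up {a : Site 2}
    (hfree : ∀ n : ℕ, s(a + n • cornerUnit 1 + cornerOff 2, a + n • cornerUnit 1 + cornerOff 3) ∉ E₀) :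
    ∀ M : ℤ, ∃ g' : Site 2, M ≤ g' 1 ∧ Relation.ReflTransGen S a g' := by
  have chain : ∀ n : ℕ, Relation.ReflTransGen S a (a + n • cornerUnit 1) := by
    intro n
    induction n with
    | zero => rw [zero_nsmul, add_zero]
    | succ n ih =>
      refine ih.tail ((hS _ _).2 ⟨1, by rw [add_succ_nsmul_cornerUnit], ?_⟩)
      exact hfree n
  intro M
  obtain ⟨n, hn⟩ : ∃ n : ℕ, M ≤ a 1 + n := ⟨(M - a 1).toNat, by omega⟩
  refine ⟨a + n • cornerUnit 1, ?_, chain n⟩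
  rw [add_nsmul_cornerUnit_apply]; simpa using hn

end Step

include hS in
/-- **Faces above, right of or left of all vertices of `E₀` escape** (straight up). [folklore] -/
theorem esc_of_outside {X₁ X₂ Y₂ : ℤ} (hbox : ∀ v ∈ verts E₀, X₁ ≤ v 0 ∧ v 0 ≤ X₂ ∧ v 1 ≤ Y₂) {a : Site 2}
    (ha : Y₂ ≤ a 1 ∨ X₂ < a 0 ∨ a 0 + 1 < X₁) :
    ∀ M : ℤ, ∃ g' : Site 2, M ≤ g' 1 ∧ Relation.ReflTransGen S a g' := by
  refine esc_of_free_up hS fun n hn => ?_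
  -- the top side of `a + n e₁` has both ends off the vertices of `E₀`
  have h1 := hbox _ (mem_verts_of_mem hn)
  have hn' : s(a + n • cornerUnit 1 + cornerOff 3, a + n • cornerUnit 1 + cornerOff 2) ∈ E₀ := by
    rw [Sym2.eq_swap]; exact hn
  have h2 := hbox _ (mem_verts_of_mem hn')
  simp only [Pi.add_apply] at h1 h2
  simp [cornerOff, cornerUnit] at h1 h2
  omega

include hS in
/-- **Faces below all vertices of `E₀` escape** (left, then up). [folklore] -/
theorem esc_of_below {X₁ X₂ Y₁ Y₂ : ℤ} (hbox : ∀ v ∈ verts E₀, X₁ ≤ v 0 ∧ v 0 ≤ X₂ ∧ Y₁ ≤ v 1 ∧ v 1 ≤ Y₂)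
    {a : Site 2} (ha : a 1 + 1 < Y₁) :
    ∀ M : ℤ, ∃ g' : Site 2, M ≤ g' 1 ∧ Relation.ReflTransGen S a g' := by
  -- walk left to `a + n e₂` with `a 0 - n + 1 < X₁`
  have chain : ∀ n : ℕ, Relation.ReflTransGen S a (a + n • cornerUnit 2) := by
    intro n
    induction n with
    | zero => rw [zero_nsmul, add_zero]
    | succ n ih =>
      refine ih.tail ((hS _ _).2 ⟨2, by rw [add_succ_nsmul_cornerUnit], ?_⟩)
      intro hn
      have h1 := hbox _ (mem_verts_of_mem hn)
      simp only [Pi.add_apply] at h1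
      simp [cornerOff, cornerUnit] at h1
      omega
  obtain ⟨n, hn⟩ : ∃ n : ℕ, a 0 - n + 1 < X₁ := ⟨(a 0 - X₁ + 2).toNat, by omega⟩
  have hesc := esc_of_outside hS (fun v hv => ⟨(hbox v hv).1, (hbox v hv).2.1, (hbox v hv).2.2.2⟩)
    (a := a + n • cornerUnit 2) (Or.inr (Or.inr (by rw [add_nsmul_cornerUnit_apply]; simp; omega)))
  exact esc_of_reflTransGen hS (reflTransGen_holeStep_symm hS (chain n)) hesc

include hS in
/-- **The hole is finite.** [folklore] -/
theorem finite_hole : {a : Site 2 | ¬ ∀ M : ℤ, ∃ g' : Site 2, M ≤ g' 1 ∧ Relation.ReflTransGen S a g'}.Finite := by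
  -- a bounding box of the vertices
  obtain ⟨X₂, hX₂⟩ := ((verts E₀).finite_toSet.image fun v => v 0).bddAbove
  obtain ⟨X₁, hX₁⟩ := ((verts E₀).finite_toSet.image fun v => v 0).bddBelow
  obtain ⟨Y₂, hY₂⟩ := ((verts E₀).finite_toSet.image fun v => v 1).bddAbove
  obtain ⟨Y₁, hY₁⟩ := ((verts E₀).finite_toSet.image fun v => v 1).bddBelow
  have hbox : ∀ v ∈ verts E₀, X₁ ≤ v 0 ∧ v 0 ≤ X₂ ∧ Y₁ ≤ v 1 ∧ v 1 ≤ Y₂ := fun v hv =>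
    ⟨hX₁ ⟨v, hv, rfl⟩, hX₂ ⟨v, hv, rfl⟩, hY₁ ⟨v, hv, rfl⟩, hY₂ ⟨v, hv, rfl⟩⟩
  have hfin : (Set.Icc (X₁ - 1) X₂ ×ˢ Set.Icc (Y₁ - 1) Y₂ : Set (ℤ × ℤ)).Finite :=
    (Set.finite_Icc _ _).prod (Set.finite_Icc _ _)
  refine (hfin.preimage (f := fun r : Site 2 => (r 0, r 1)) fun r _ r' _ h => ?_).subset fun a ha => ?_
  · simp only [Prod.mk.injEq] at h
    exact funext fun i => by fin_cases i <;> simp [h.1, h.2]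
  · simp only [Set.mem_preimage, Set.mem_prod, Set.mem_Icc]
    simp only [Set.mem_setOf_eq] at ha
    have hb := fun v hv => (⟨(hbox v hv).1, (hbox v hv).2.1, (hbox v hv).2.2.2⟩ : X₁ ≤ v 0 ∧ v 0 ≤ X₂ ∧ v 1 ≤ Y₂)
    refine ⟨⟨?_, ?_⟩, ?_, ?_⟩ <;> by_contra hc <;> push Not at hc
    · exact ha (esc_of_outside hS hb (Or.inr (Or.inr (by omega))))
    · exact ha (esc_of_outside hS hb (Or.inr (Or.inl hc)))
    · exact ha (esc_of_below hS hbox (by omega))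
    · exact ha (esc_of_outside hS hb (Or.inl hc.le))

/-! ### Round a corner off the vertices of `E₀` -/

include hS in
/-- **Round a corner of a hole face that is not a vertex of `E₀`, all four faces are hole faces.**
[folklore] -/
theorem hole_faceAt_of_not_mem_verts {h v : Site 2}
    (hh : ¬ ∀ M : ℤ, ∃ g' : Site 2, M ≤ g' 1 ∧ Relation.ReflTransGen S h g') (hv : IsCorner v h)
    (hvE : v ∉ verts E₀) (i : Fin 4) :
    ¬ ∀ M : ℤ, ∃ g' : Site 2, M ≤ g' 1 ∧ Relation.ReflTransGen S (faceAt v i) g' := by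
  obtain ⟨i₀, hi₀⟩ := exists_faceAt_of_isCorner hv
  -- one step round `v`
  have hstep : ∀ i : Fin 4, (¬ ∀ M : ℤ, ∃ g' : Site 2, M ≤ g' 1 ∧ Relation.ReflTransGen S (faceAt v i) g') →
      ¬ ∀ M : ℤ, ∃ g' : Site 2, M ≤ g' 1 ∧ Relation.ReflTransGen S (faceAt v (i + 1)) g' := by
    intro i hi
    refine not_esc_of_step ((hS _ _).2 ⟨i + 2, by rw [faceAt_succ_eq], ?_⟩) hi
    rw [fin4_add_two_add_one, fin4_add_two_add_two', show faceAt v i + cornerOff i = v by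
      rw [faceAt, sub_add_cancel]]
    exact fun hmem => hvE (mem_verts_of_mem hmem)
  have h0 : ¬ ∀ M : ℤ, ∃ g' : Site 2, M ≤ g' 1 ∧ Relation.ReflTransGen S (faceAt v i₀) g' := hi₀ ▸ hh
  have h1 := hstep _ h0
  have h2 := hstep _ h1
  have h3 := hstep _ h2
  have : i = i₀ ∨ i = i₀ + 1 ∨ i = i₀ + 1 + 1 ∨ i = i₀ + 1 + 1 + 1 := by omega
  rcases this with rfl | rfl | rfl | rfl
  · exact h0
  · exact h1
  · exact h2
  · exact h3

/-! ### The closure property and its consequences -/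

include hS hE₀ in
/-- **The closure property of the hole** (hypothesis of `…WindowRectHoleCells`): a common corner of a hole
face and a side-adjacent non-hole face lies in `D`, and the common side in `closure D` — the common side is
an edge of `Ω_δ`. [folklore] -/
theorem hole_closure_property :
    ∀ a ∈ {a : Site 2 | ¬ ∀ M : ℤ, ∃ g' : Site 2, M ≤ g' 1 ∧ Relation.ReflTransGen S a g'},
    ∀ b ∉ {a : Site 2 | ¬ ∀ M : ℤ, ∃ g' : Site 2, M ≤ g' 1 ∧ Relation.ReflTransGen S a g'},
    (zdGraph 2).Adj a b → ∀ v : Site 2, IsCorner v a → IsCorner v b →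
      meshPoint δ v ∈ D.carrier ∧ ∀ w : Site 2, IsCorner w a → IsCorner w b → (zdGraph 2).Adj v w →
        segment ℝ (meshPoint δ v) (meshPoint δ w) ⊆ closure D.carrier := by
  intro a ha b hb hab v hva hvb
  simp only [Set.mem_setOf_eq, not_not] at ha hb
  obtain ⟨k, rfl⟩ := exists_eq_add_cornerUnit hab
  have hmem := mem_of_hole_of_not_hole hS ha hb
  have hadj : (discreteDomainGraph D.carrier δ).Adj (a + cornerOff (k + 1)) (a + cornerOff (k + 2)) := by
    have := hE₀ _ hmem
    rwa [SimpleGraph.mem_edgeSet] at this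
  obtain ⟨hmg, hp, hq⟩ := discreteDomainGraph_adj_iff.1 hadj
  have hseg := (meshGraph_adj_iff.1 hmg).2
  have hpD : meshPoint δ (a + cornerOff (k + 1)) ∈ D.carrier := meshDomain_subset_meshVertices _ _ hp
  have hqD : meshPoint δ (a + cornerOff (k + 2)) ∈ D.carrier := meshDomain_subset_meshVertices _ _ hq
  refine ⟨?_, fun w hwa hwb hvw => ?_⟩
  · rcases eq_of_isCorner_of_isCorner_add hva hvb with rfl | rfl
    · exact hpD
    · exact hqD
  · rcases eq_of_isCorner_of_isCorner_add hva hvb with rfl | rfl <;>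
      rcases eq_of_isCorner_of_isCorner_add hwa hwb with rfl | rfl
    · exact absurd rfl hvw.ne
    · exact hseg
    · rw [segment_symm]; exact hseg
    · exact absurd rfl hvw.ne

include hS hE₀ hδ in
/-- **Every corner of a hole face has its mesh point in `D`.** [folklore] -/
theorem meshPoint_corner_mem_hole {h : Site 2}
    (hh : ¬ ∀ M : ℤ, ∃ g' : Site 2, M ≤ g' 1 ∧ Relation.ReflTransGen S h g') {v : Site 2} (hv : IsCorner v h) :
    meshPoint δ v ∈ D.carrier :=
  meshPoint_corner_mem_of_hole D hδ (finite_hole hS) (hole_closure_property D hE₀ hS) hh hv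

include hS hE₀ hδ in
/-- **Every corner of a hole face lies in `Ω_δ = meshDomain`.** [folklore] -/
theorem corner_mem_meshDomain_hole {h : Site 2}
    (hh : ¬ ∀ M : ℤ, ∃ g' : Site 2, M ≤ g' 1 ∧ Relation.ReflTransGen S h g') {v : Site 2} (hv : IsCorner v h) :
    v ∈ meshDomain D.carrier δ := by
  obtain ⟨a, b, u, ha, hb, hab, hua, hub, h₁, h₂, hreach⟩ :=
    exists_reachable_exit_of_hole D hδ (finite_hole hS) (hole_closure_property D hE₀ hS) hh hv
  simp only [Set.mem_setOf_eq, not_not] at hb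
  -- `u` is an end of the common side, an edge of `Ω_δ`
  obtain ⟨k, rfl⟩ := exists_eq_add_cornerUnit hab
  have hmem := mem_of_hole_of_not_hole hS ha hb
  have hadj : (discreteDomainGraph D.carrier δ).Adj (a + cornerOff (k + 1)) (a + cornerOff (k + 2)) := by
    have := hE₀ _ hmem
    rwa [SimpleGraph.mem_edgeSet] at this
  obtain ⟨-, hp, hq⟩ := discreteDomainGraph_adj_iff.1 hadj
  have huD : u ∈ meshDomain D.carrier δ := by
    rcases eq_of_isCorner_of_isCorner_add hua hub with rfl | rfl
    · exact hp
    · exact hq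
  exact mem_meshDomain_of_reachable_meshVertexGraph huD h₂ h₁ hreach.symm

include hS hE₀ hδ in
/-- **The sides of hole faces are edges of `Ω_δ`.** [folklore] -/
theorem adj_of_hole_side {h : Site 2}
    (hh : ¬ ∀ M : ℤ, ∃ g' : Site 2, M ≤ g' 1 ∧ Relation.ReflTransGen S h g') {v w : Site 2} (hv : IsCorner v h)
    (hw : IsCorner w h) (hvw : (zdGraph 2).Adj v w) : (discreteDomainGraph D.carrier δ).Adj v w :=
  discreteDomainGraph_adj_iff.2 ⟨meshGraph_adj_of_hole D hδ (finite_hole hS) (hole_closure_property D hE₀ hS) hh hv hw hvw,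
    corner_mem_meshDomain_hole D hδ hE₀ hS hh hv, corner_mem_meshDomain_hole D hδ hE₀ hS hh hw⟩

end WindowRect

/-- **The sides of hole faces are edges of `Ω_δ`**, closed form (registered sub-goal of
stmt-CriticalPhenomena-10650). [folklore] -/
theorem windowRect_adj_of_hole_side : ∀ (D : Literature.Probability.RandomPlanarGeometry.JordanDomain) {δ : ℝ}, 0 < δ → ∀ {E₀ : Finset (Sym2 (Site 2))}, (∀ e ∈ E₀, e ∈ (discreteDomainGraph D.carrier δ).edgeSet) → ∀ {S : Site 2 → Site 2 → Prop}, (∀ a b, S a b ↔ ∃ k : Fin 4, b = a + cornerUnit k ∧ s(a + cornerOff (k + 1), a + cornerOff (k + 2)) ∉ E₀) → ∀ {h : Site 2}, (¬ ∀ M : ℤ, ∃ g' : Site 2, M ≤ g' 1 ∧ Relation.ReflTransGen S h g') → ∀ {v w : Site 2}, IsCorner v h → IsCorner w h → (zdGraph 2).Adj v w → (discreteDomainGraph D.carrier δ).Adj v w :=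
  fun D _ hδ _ hE₀ _ hS _ hh _ _ hv hw hvw => WindowRect.adj_of_hole_side D hδ hE₀ hS hh hv hw hvw

end Summit.CriticalPhenomena.SAWScalingLimit.Theorems.IsingBoundaryRatio

end
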